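import Mathlib
import HarnessLib
import Summits.HubbardSuperconductivity.HubbardSuperconductivity.Theorems.KLProgrammeKLRegimeSplitGeoRaiseTwoLeg
import Summits.HubbardSuperconductivity.HubbardSuperconductivity.Theorems.KLProgrammeKLRegimeSplitEngRaiseCE
import Summits.HubbardSuperconductivity.HubbardSuperconductivity.Theorems.KLProgrammeKLRegimeSplitBundleV16
import Summits.HubbardSuperconductivity.HubbardSuperconductivity.Theorems.KLProgrammeKLRegimeEngineV8DefsU4

/-!
# The COMPOSITE package doors `(klEngGeo5, klEngQ5 P R) ⟶ (klEngGeo5.raiseTwoLeg s sl, (klEngQ5 P R).raiseCE ce s')`, PARAMETRIC in the raise data —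
# the part of `…EngineV8DefsG6Q6` (plan g14 (R20)(3)(b)) that does not wait on the (X, μ_l, ν_l) numerals
# (cell gate-hubbard-kl, seat hubbard-kl-k3c2-p2 g6)

Once the engine lane fixes the by-formula sizes (k3c3-p3's (F-G) `S_j`, (F-Q) `CE(R)`), `…DefsG6Q6` is `klEngGeo6 := klEngGeo5.raiseTwoLeg klMsS sl`,
`klEngQ6 P R := (klEngQ5 P R).raiseCE (klMsCE P R) (klMsS' P R)` plus these doors instantiated.  For ANY `s sl ce s'`:

* `klEng_engineBoundsAtV10S_raise_of` — the whole V10 engine slot lifts (`P.WF` for `0 ≤ Klam`);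
* `klEng_kernelNormsV4_raise_of` ((E1-v4) alone), `klEng_scaleZeroConj_raise_of` (the five-clause conclusion of `stub_engine_scale0`),
  `klEng_stepValuesConj_raise_of` (the five-clause conclusion of `stub_engine_step_values`);
* `klEng_twoLegCoreTD_raise_of` (the (E3a-T1)/(E3c-TD)/(E3d-e) core at a FIXED history), `klEng_twoLegSizesMSTQ_raise_of` ((E3a-MS-TQ); `R.WF`);
* `klEng_pairTolerance_raise_eq` (the PairArrayAtV2 tolerance constant does not read `CE`/`S'`: the DefsU4 smallness transfers verbatim),
  `klvr11_pairValueIncrement_inClass_klEng_raise` (in-class (E2″-v7) at the raised package under `U ≤ klEngU₀4`).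

NOT provided (false by monotonicity): lifts of `TwoLegStepV16` as a whole or of `HistP klPredsV16 … (raised) …` hypotheses.  Order lemmas only.
-/

noncomputable section

namespace Summit.HubbardSuperconductivity.HubbardSuperconductivity.Theorems.EngineV8

set_option linter.dupNamespace false -- summit = problem name (single-conjunct summit), D-0017

open Real Finset Literature.MathematicalPhysics.QuantumLattice Literature.Probability.LatticeModels
open Summit.HubbardSuperconductivity.HubbardSuperconductivity.Theorems.KLRegimeSplit
open Summit.HubbardSuperconductivity.HubbardSuperconductivity.Theorems.KLProgrammeLegKernels

section Model

variable {L M : ℕ} [NeZero L] [NeZero M] {P : SplitConsts} {R : RenConsts} {β U μ : ℝ} {K : TrigPolyC4v} {n : ℕ}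
  (s : ℕ → ℝ) (sl ce : ℝ) (s' : ℕ → ℝ)

/-- **The V10 engine slot lifts to the raised package** (`P.WF`). -/
theorem klEng_engineBoundsAtV10S_raise_of (hP : P.WF) (h : EngineBoundsAtV10S L M klEngGeo5 P (klEngQ5 P R) β U μ K n) :
    EngineBoundsAtV10S L M (klEngGeo5.raiseTwoLeg s sl) P ((klEngQ5 P R).raiseCE ce s') β U μ K n :=
  (engineBoundsAtV10S_raiseTwoLeg_iff s sl).2 (engineBoundsAtV10S_raiseCE_of (klEngQ5_wf P R) (zero_le_one.trans hP.1) h)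

omit [NeZero M] in
/-- (E1-v4) lifts to the raised `Q` (`P.WF`). -/
theorem klEng_kernelNormsV4_raise_of (hP : P.WF) (h : KernelNormsV4 L M P (klEngQ5 P R) β U μ K n) :
    KernelNormsV4 L M P ((klEngQ5 P R).raiseCE ce s') β U μ K n :=
  kernelNormsV4_raiseCE_of (klEngQ5_wf P R) (zero_le_one.trans hP.1) h

/-- **The five-clause conclusion of `stub_engine_scale0` lifts** to the raised package (`P.WF`). -/
theorem klEng_scaleZeroConj_raise_of (hP : P.WF)
    (h : KernelNormsV4 L M P (klEngQ5 P R) β U μ K 0 ∧ PairLadderStepAtV10 L M klEngGeo5 P (klEngQ5 P R) β U μ K 0 ∧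
      QuarticValueUVAtS3 L M klEngGeo5 P (klEngQ5 P R) β U μ K 0 ∧ EngineFirstMoments L M klEngGeo5 P (klEngQ5 P R) β U μ K 0 ∧
        IsoTupleL1AtS L M klEngGeo5 P β U μ K 0) :
    KernelNormsV4 L M P ((klEngQ5 P R).raiseCE ce s') β U μ K 0 ∧
      PairLadderStepAtV10 L M (klEngGeo5.raiseTwoLeg s sl) P ((klEngQ5 P R).raiseCE ce s') β U μ K 0 ∧
        QuarticValueUVAtS3 L M (klEngGeo5.raiseTwoLeg s sl) P ((klEngQ5 P R).raiseCE ce s') β U μ K 0 ∧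
          EngineFirstMoments L M (klEngGeo5.raiseTwoLeg s sl) P ((klEngQ5 P R).raiseCE ce s') β U μ K 0 ∧
            IsoTupleL1AtS L M (klEngGeo5.raiseTwoLeg s sl) P β U μ K 0 := by
  obtain ⟨h1, h2, h3, h4, h5⟩ := h
  exact ⟨klEng_kernelNormsV4_raise_of ce s' hP h1, (pairLadderStepAtV10_raiseCE_iff ce s').2 h2,
    (quarticValueUVAtS3_raiseCE_iff ce s').2 h3, (engineFirstMoments_raiseCE_iff ce s').2 h4, h5⟩

/-- **The five-clause conclusion of `stub_engine_step_values` lifts** to the raised package. -/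
theorem klEng_stepValuesConj_raise_of
    (h : PairLadderStepAtV10 L M klEngGeo5 P (klEngQ5 P R) β U μ K n ∧ PairValueIncrementAtV7 L M klEngGeo5 P (klEngQ5 P R) β U μ K n ∧
      QuarticValueIncrementAtS4 L M klEngGeo5 P (klEngQ5 P R) β U μ K n ∧ EngineFirstMoments L M klEngGeo5 P (klEngQ5 P R) β U μ K n ∧
        IsoTupleL1AtS L M klEngGeo5 P β U μ K n) :
    PairLadderStepAtV10 L M (klEngGeo5.raiseTwoLeg s sl) P ((klEngQ5 P R).raiseCE ce s') β U μ K n ∧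
      PairValueIncrementAtV7 L M (klEngGeo5.raiseTwoLeg s sl) P ((klEngQ5 P R).raiseCE ce s') β U μ K n ∧
        QuarticValueIncrementAtS4 L M (klEngGeo5.raiseTwoLeg s sl) P ((klEngQ5 P R).raiseCE ce s') β U μ K n ∧
          EngineFirstMoments L M (klEngGeo5.raiseTwoLeg s sl) P ((klEngQ5 P R).raiseCE ce s') β U μ K n ∧
            IsoTupleL1AtS L M (klEngGeo5.raiseTwoLeg s sl) P β U μ K n := by
  obtain ⟨h1, h2, h3, h4, h5⟩ := h
  exact ⟨(pairLadderStepAtV10_raiseCE_iff ce s').2 h1, (pairValueIncrementAtV7_raiseCE_iff ce s').2 h2,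
    (quarticValueIncrementAtS4_raiseCE_iff ce s').2 h3, (engineFirstMoments_raiseCE_iff ce s').2 h4, h5⟩

/-- **The two-leg core at a FIXED history lifts** (`R` untouched). -/
theorem klEng_twoLegCoreTD_raise_of {hist : TrigPolyC4v → ℕ → Prop}
    (h : TwoLegCoreTD L M hist klEngGeo5 P (klEngQ5 P R) R β U μ K n) :
    TwoLegCoreTD L M hist (klEngGeo5.raiseTwoLeg s sl) P ((klEngQ5 P R).raiseCE ce s') R β U μ K n :=
  twoLegCoreTD_raiseTwoLeg_of (twoLegCoreTD_raiseCE_of klEngGeo5_wf h)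

/-- **(E3a-MS-TQ) lifts** (`R.WF`). -/
theorem klEng_twoLegSizesMSTQ_raise_of (hR : R.WF) (h : TwoLegSizesMSTQ L M klEngGeo5 (klEngQ5 P R) R β U μ K n) :
    TwoLegSizesMSTQ L M (klEngGeo5.raiseTwoLeg s sl) ((klEngQ5 P R).raiseCE ce s') R β U μ K n :=
  twoLegSizesMSTQ_raiseTwoLeg_of (EngConsts.raiseCE_wf (klEngQ5_wf P R) ce s') hR
    (twoLegSizesMSTQ_raiseCE_of klEngGeo5_wf (klEngQ5_wf P R) hR h)

omit [NeZero L] [NeZero M] in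
/-- The `PairArrayAtV2` tolerance constant does not read `CE`/`S'`: `(Q.raiseCE ce s').CR = Q.CR`. -/
theorem klEng_pairTolerance_raise_eq :
    P.C_W + klLegKappa * ((klEngQ5 P R).raiseCE ce s').CR * P.Klam ^ 3 = P.C_W + klLegKappa * (klEngQ5 P R).CR * P.Klam ^ 3 := rfl

/-- **In-class (E2″-v7) at the raised package under the binders** (`P.WF`, `R.WF`, `0 < U ≤ klEngU₀4 P R c`, `1 ≤ n`): from (E2-v10) at the raised
package and `BetaSplitAtS2 … (n−1)` (any `G`, raised `Q` — the clause reads `CR` only). -/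
theorem klvr11_pairValueIncrement_inClass_klEng_raise (hP : P.WF) (hR : R.WF) {c : ℝ} (hU : 0 < U) (hU₀ : U ≤ klEngU₀4 P R c)
    (hn : 1 ≤ n) (hlad : PairLadderStepAtV10 L M (klEngGeo5.raiseTwoLeg s sl) P ((klEngQ5 P R).raiseCE ce s') β U μ K n)
    {G : GeoConsts} (hsplit : BetaSplitAtS2 L M G P ((klEngQ5 P R).raiseCE ce s') β U μ K (n - 1))
    {Qm : TorusSite 2 L} (hQm : IsPairClassAt L Qm n) :
    ∀ k ∈ klBall L μ K, ∀ k' ∈ klBall L μ K,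
      ‖klPairAmplitude L M β U μ K n Qm k k' - klPairAmplitude L M β U μ K (n - 1) Qm k k'‖ ≤
        gainBar (klEngGeo5.raiseTwoLeg s sl) P U n (klTorusNorm L Qm) (klTorusNorm L (k - k')) (klTorusNorm L (k + k' - Qm)) +
          eremBar (klEngGeo5.raiseTwoLeg s sl) P ((klEngQ5 P R).raiseCE ce s') U β L (n - 1) +
            thermalBar (klEngGeo5.raiseTwoLeg s sl) P U β n +
            legDressBarQ2 (klEngGeo5.raiseTwoLeg s sl) P ((klEngQ5 P R).raiseCE ce s') U n
              (legSliceCountT L β μ K n ![k', Qm - k', Qm - k, k]) := by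
  -- the raised value clauses are the unraised ones (`G`-raise: definitional; `Q`-raise: the `Iff.rfl` doors)
  have h1 : PairLadderStepAtV10 L M klEngGeo5 P ((klEngQ5 P R).raiseCE ce s') β U μ K n := hlad
  have hlad' : PairLadderStepAtV10 L M klEngGeo5 P (klEngQ5 P R) β U μ K n := (pairLadderStepAtV10_raiseCE_iff ce s').1 h1
  have hsplit' : BetaSplitAtS2 L M G P (klEngQ5 P R) β U μ K (n - 1) := (betaSplitAtS2_raiseCE_iff ce s').1 hsplit
  have key := klvr11_pairValueIncrement_inClass_klEng_of_split hP hR hU hU₀ hn hlad' hsplit' hQm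
  intro k hk k' hk'
  rw [gainBar_raiseTwoLeg, eremBar_raiseTwoLeg, thermalBar_raiseTwoLeg, legDressBarQ2_raiseTwoLeg, eremBar_raiseCE,
    legDressBarQ2_raiseCE]
  exact key k hk k' hk'

end Model

end Summit.HubbardSuperconductivity.HubbardSuperconductivity.Theorems.EngineV8

end
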